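import Literature.NumberTheory.EllipticCurves.AnticyclotomicSignedHeegnerClasses
import Literature.NumberTheory.EllipticCurves.CastellaWan2024.GreenbergMainConjectureBDP
import HarnessLib

/-!
# Castella–Wan's passage from the signed Heegner-point side to the Greenberg/BDP side (§6.2):
# Cor. 6.4 (the localisation of `z^±_∞` at `𝔭` is not `Λ^ac`-torsion), Lemma 6.7 (ranks and
# torsion characteristic ideals of the nine groups) and the composite Thm. A.5 + Thm. 6.8
# "`L_p^BDP ∈ char_{Λac}(X^{rel,str}) Λ^ur`", as named facts on the tree's signed carriers

Topic `Literature/NumberTheory/EllipticCurves`; namespace `Literature.NumberTheory.EllipticCurves.AcSigned`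
(the object namespace of `AnticyclotomicSignedSelmer.lean` — discrete carriers `selmer`, duals `X`,
`Setting` —, `AnticyclotomicSignedCompactSelmer.lean` — compact carriers `selmerLambdaAdic` with the
`ℤ_p⟦T⟧`-structure `moduleOfGen` — and `AnticyclotomicSignedHeegnerClasses.lean` — the pinning
predicate `IsSignedHeegnerClass`, `signedHeegnerCharIdeal`, `IsNonTorsionClass` —, which this file
continues). Cell `pub/bsd-wall` (rung W-ALL of the BSD summit), literature-typer seat
`bsd-wall-utd-ty1` (generation 3; director-bsd g12 (142)(e)), `--supports`
stmt-BirchSwinnertonDyer-23594 = crux `TwinSplitIMCAtThreeGoodSSApZero` of the route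
`UniversalToricDescent`. Its `⊇`/Howard half (`stub_howardFrameSS_apZero` of the registered line
`threeframes_apzero`) is a PORT to `p = 3`, `a_3 = 0` of the deduction typed here IN PRINT CURRENCY:
Castella–Wan's Thm. A.5 (the `±` Heegner-point Kolyvagin system bounds `X_±`) composed with the
"opposite divisibilities" clause of Thm. 6.8 (transfer through the explicit reciprocity law Thm. 6.2,
the global-duality sequences (6.12)–(6.13) and Lemma 6.7) gives `char_{Λac}(X^{rel,str}) Λ^ur ⊃
(L_p^BDP)` — the conclusion of the crux's stub, there at `p = 3`. HONEST FRAMING: ONE definition with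
a body (a predicate), THREE statement-only named facts (`def … : Prop`, D-0014; hypotheses as printed
— in particular `p > 3` VERBATIM —, specialised as documented; nothing asserted, no `_holds`, no
instance, no notation) and small PROVED API. The facts are NOT usable at `p = 3`; they record the
ENGINE the crux must re-prove at `p = 3`, on the tree's carriers, so that the `p = 3` theorems can be
STATED by deleting `3 < p`. Typed ≠ proved ≠ endorsed; BSD is not advanced by this file; the crux
stays open.

## What is typed here

1. (Part 1) **`IsLocNonTorsionAt W p κ γ 𝔮 hγ ε z`** for `z ∈ Sel_ε(K, 𝐓^ac) = selmerLambdaAdic …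
   (fun _ ↦ .sgn ε)`: "`loc_𝔮(z)` is not `Λ^ac`-torsion" in KERNEL FORM — for `f ∈ Λ^ac`, if `f·z`
   lies in the subgroup `Sel^{str at 𝔮, ε elsewhere}(K, 𝐓^ac)` (the kernel of `loc_𝔮` on
   `Sel_ε(K, 𝐓^ac)`, (6.13)) then `f = 0`. This is the shape of Castella–Wan's Cor. 6.4 "The class
   `loc_𝔭(z^±_∞)` is not `Λ^ac`-torsion" that needs no local Iwasawa cohomology (flag
   `str-vs-loc-zero`). PROVED: it implies `IsNonTorsionClass` (Conj. 4.8 (1)'s shape), and it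
   descends along `Λ^ac`-multiples.
2. (Part 2) three NAMED FACTS, `p > 3` VERBATIM:
   * `castellaWan2024_cor64_isLocNonTorsionAt` — Cor. 6.4 (with Lemma 4.7 and, in its printed proof,
     Thm. 6.2 and Thm. 2.3): the signed Heegner class is not torsion at `𝔭`;
   * `castellaWan2024_lemma67_finrank_torsionCharIdeal` — Lemma 6.7 (1) `rank X_± = rank Sel_±(K,
     𝐓^ac)` and (2) `rank X^{rel,±} = 1 + rank X^{±,str}`, `char(X^{rel,±}_tors) = char(X^{±,str}_tors)`;
   * `castellaWan2024_thmA5_thm68_bdp_mem_charIdeal` — Thm. A.5 + Thm. 6.8 (opposite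
     divisibilities): for `N` squarefree, `Sel^{str,rel}(K, 𝐓^ac)` and `X^{rel,str}` are
     `Λ^ac`-torsion and `L_p^BDP ∈ char_{Λac}(X^{rel,str}) Λ^ur`, in the currency of the tree's
     `CastellaWan2024.thm53_exists_isCWBDPLFunction_charIdeal_map_le` (same frame predicate
     `IsCWBDPLFunction`, same dual `AcSelmer.XAc … 𝔭̄`, same orientation).

## Sources, VERBATIM (texts read by this seat 2026-08-28; locators)

* [CastellaWan2023] F. Castella, X. Wan, *Perrin-Riou's main conjecture for elliptic curves at
  supersingular primes*, Math. Ann. 389 (2024) 2595–2636 = authors' accepted MS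
  `paper:url-7157bd4f7b88` (https://web.math.ucsb.edu/~castella/Perrin-Riou.pdf, 39 pp.; journal
  p = MS p + 2594). §6 standing hypotheses (MS p. 25): "Let `E/ℚ` be an elliptic curve of conductor
  `N`, `f = Σ a_n q^n ∈ S_2(Γ_0(N))` the newform associated with `E`, `p > 3` a prime of good
  supersingular reduction for `E`, and `K` an imaginary quadratic field satisfying hypotheses (gen-H)
  and (spl)"; (gen-H) (MS p. 5) "`N⁻` is the squarefree product of an even number of primes"
  (`N = N⁺N⁻`, `N⁺` divisible only by split or ramified primes); (spl) "`(p) = 𝔭𝔭̄` splits in `K`,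
  with `𝔭` the prime of `K` above `p` induced by `ι_p`". **Lemma 4.7** (MS p. 22) "For each prime
  `v` of `K` above `p` we have `loc_v(z^±_∞) ∈ H¹_±(K_v, 𝐓^ac)`". **Def. 5.1** (MS p. 23) "for
  `v ∈ {𝔭, 𝔭̄}` and `𝓛_v ∈ {rel, ±, str}` … `Sel^𝓛(K, M)` … `X^𝓛` the Pontryagin dual of
  `Sel^𝓛(K, 𝐀^ac)` … `Sel^{rel,str}(K, 𝐀^ac)` consists of classes which are trivial at `𝔭̄` and satisfy
  no condition at `𝔭`". **Thm. 6.2** (MS p. 26) "`𝓛^BDP_𝔭 / Ξ_d = σ_{−1,𝔭} · Log^±_𝔭(loc_𝔭(z^±_∞))`".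
  **Cor. 6.4** (MS p. 27) "The class `loc_𝔭(z^±_∞)` is not `Λ^ac`-torsion. *Proof.* Immediate from
  Theorem 6.2 and the non-vanishing result for `𝓛^BDP_𝔭` in Theorem 2.3". **Lemma 6.7** (MS p. 28)
  "The following hold: (1) The modules `X_±` and `Sel_±(K, 𝐓^ac)` have the same `Λ^ac`-rank.
  (2) `rank_{Λac}(X^{rel,±}) = 1 + rank_{Λac}(X^{±,str})` and `char_{Λac}(X^{rel,±}_tors) =
  char_{Λac}(X^{±,str}_tors)`, where the subscript tors denotes the `Λ^ac`-torsion submodule" (proof: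
  Lemmas 6.5, 6.6, [Kim07, Prop. 4.11] "the local conditions … for `v ∣ p` are self-dual", [MR04, Thm.
  4.1.13], (6.8) core rank `2 + 1 − 2 = 1` "By Proposition 3.8", (6.9), [AH06, Lem. 1.2.6]).
  **Thm. 6.8** (MS p. 30) "The following are equivalent: (i) Both `Sel_±(K, 𝐓^ac)` and `X_±` have
  `Λ^ac`-rank one, and the following divisibility holds in `Λ^ac`: `char_{Λac}(X^±_tors) ⊂
  char_{Λac}(Sel_±(K, 𝐓^ac)/Λ^ac z^±_∞)²`. (ii) Both `Sel^{str,rel}(K, 𝐓^ac)` and `X^{rel,str}` are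
  `Λ^ac`-torsion, and the following divisibility holds in `Λ^ur`: `char_{Λac}(X^{rel,str}) Λ^ur ⊂
  (L_p^BDP)`. The same result holds for the opposite divisibilities. In particular, Conjectures 4.8
  and 5.2 are equivalent" (proof, MS pp. 30–31: "`E(K)[p] = 0` … hence `E(K_∞)[p^∞] = 0`, which by
  [PR00, §1.3.3] implies that the `Λ^ac`-torsion submodule of `H¹(K, 𝐓^ac)` is trivial. Global duality
  yields … **(6.12)** `0 → Sel^{str,rel}(K, 𝐓^ac) → Sel^{±,rel}(K, 𝐓^ac) —loc_𝔭→ H¹_±(K_𝔭, 𝐓^ac) →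
  X^{rel,str} → X^{±,str} → 0`. Since `H¹_±(K_𝔭, 𝐓^ac) ≃ Λ^ac` (see Proposition 3.8) … `Sel_±(K, 𝐓^ac)
  = Sel^{±,rel}(K, 𝐓^ac)` … **(6.13)** `0 → Sel^{str,±}(K, 𝐓^ac) → Sel_±(K, 𝐓^ac) —loc_𝔭→ H¹_±(K_𝔭,
  𝐓^ac) → X^{rel,±} → X_± → 0` … `Sel^{str,±}(K, 𝐓^ac) = 0`, since it is of `Λ^ac`-rank zero …
  **(6.14)** `char(Sel_±(K, 𝐓^ac)/Λ^ac z^±_∞) · char(coker(loc_𝔭)) Λ^ur = (𝓛^BDP_𝔭)` … **(6.15)**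
  `char(X^{±,str}) = char(X^±_tors) · char(coker(loc_𝔭))` … `char(X^{rel,str}) · char(Sel_±(K,
  𝐓^ac)/Λ^ac z^±_∞) Λ^ur = char(X^±_tors) · (𝓛^BDP_𝔭)²`"). **(2.2)** (MS p. 8) "`L_p^BDP :=
  (𝓛^BDP_𝔭)²`"; **Prop. 2.1** (interpolation, typed as `CastellaWan2024.IsCWBDPLFunction`). App. A
  (MS pp. 33–36): **Thm. A.4** (Kolyvagin system `p^d · κ^±` with `κ^±_1 = z^±_∞`), **Thm. A.5**
  "Assume that `N` is squarefree. Then the module `Sel_±(K, 𝐓^ac)` has `Λ^ac`-rank one, and there is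
  a finitely generated `Λ^ac`-module `M` such that: (i) `X_± ∼ Λ^ac ⊕ M ⊕ M`, (ii) We have the
  divisibility `char_{Λac}(M) ⊃ char_{Λac}(Sel_±(K, 𝐓^ac)/Λ^ac z^±_∞)` in `Λ^ac`" (proof: "Since
  `z^±_∞` is not `Λ^ac`-torsion by Corollary 6.4, the Kolyvagin system `p^d · κ^±` … is non-trivial
  … by [Kim07, Prop. 4.11] the local conditions … for `v ∣ p` are self-dual … by [Edi97, Prop. 2.1]
  our assumption that `N` is squarefree and `p` is supersingular … implies that the `G_ℚ`-action o[n]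
  `E[p]` is surjective … [How04b, Thm. 2.2.2] … [How04a, Thm. 2.2.10]"); proof of **Thm. 6.9** (MS p.
  31): "In the Appendix we explain how to … deduce from Corollary 6.4 that both `X_±` and `Sel_±(K,
  𝐓^ac)` have `Λ^ac`-rank one, see Theorem A.5, and that we have the divisibility '⊆' in `Λ^ac` in the
  claimed equality of characteristic ideals. In light of the equivalences in Theorem 6.8 …".
* [BDKim2007] B. D. Kim, Compos. Math. 143 (2007) 47–72, `paper:doi-10-1112-s0010437x06002569`:
  §4 p. 12 "Throughout this section, we fix a prime `p > 3`" — so [Kim07, Prop. 4.11, 4.18], the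
  local inputs of Lemma 6.5 / 6.7 / Thm. A.5 above `p`, are themselves printed for `p > 3`.
* [HatleyLeiVigni2022] Manuscripta Math. 167 (2022), `paper:arxiv-2003.10301`, §3.1 Remark 3.1 and
  proof of Lemma 3.8 ("`H⁰(K_{n',v}, A_m) = 0` … inflation-restriction … `res : H¹(K_{n,v}, A_m) ≅
  H¹(K_{n',v}, A_m)^{𝒢_{n'/n}}`", odd `p`) — the injectivity behind the flag `str-vs-loc-zero`.

## READING FLAGS (informational — where the transcription is a reading, not a printed sentence)

* `str-vs-loc-zero`: Castella–Wan's `loc_𝔮(x) = 0` means vanishing in `H¹(K_𝔮, 𝐓^ac) = lim←_{n,m}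
  ⊕_{w ∣ 𝔮} H¹(K_{n,w}, E[p^m])`; the tree's strict condition `str` at `𝔮` (`condAboveTorsion … .str`,
  pulled back from `AcSigned.condAbove … .str` over `K_∞`) asks the image in `H¹(K_{∞,w}, E[p^∞])` to
  vanish at every `w ∣ 𝔮`. The two agree because `H¹(K_{n,w}, E[p^m]) → H¹(K_{∞,w}, E[p^∞])` is
  injective (`E(K_{∞,w})[p^∞] = 0`, Hatley–Lei–Vigni Remark 3.1 / Lemma 3.8, the tree theorem
  `…Theorems.UniversalToricDescentSignedSetting.localPointsInfty_noPPowTorsion_of_setting`); so "the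
  kernel of `loc_𝔮` on `Sel_ε(K, 𝐓^ac)`" IS `Sel^{str at 𝔮, ε elsewhere}(K, 𝐓^ac)` ((6.13) with `𝔮 = 𝔭`)
  — an identification carried by the consumer, not formalised here.
* `composite-A5-68`: `castellaWan2024_thmA5_thm68_bdp_mem_charIdeal` is the COMPOSITION of two
  displayed theorems (A.5 gives clause (i) of Thm. 6.8 with the opposite divisibility —
  `char(X^±_tors) = char(M)² ⊃ char(Sel_±/Λ^ac z^±_∞)²` —, and Thm. 6.8's "The same result holds for
  the opposite divisibilities" turns it into clause (ii) with `⊃`); the paper displays the two pieces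
  and (proof of Thm. 6.9) their composition in words, not this sentence as a numbered statement. It is
  typed `z`-free ON PURPOSE: the conclusion does not mention the Heegner class, so it is insensitive
  to the normalisation of the Heegner family (flag `heegner-normalisation`).
* `heegner-normalisation`: Castella–Wan's `z[S]` are the Kummer images of `x_S := ι_{N⁺,N⁻}(h_S) ⊗
  (a_q − q − 1)⁻¹` for a chosen parametrisation `π` (Prop. 4.1); the tree's `HeegnerFamily` fixes its
  own parametrisation datum `Dt`. Cor. 6.4 (non-torsion) is insensitive to rescaling `z` by a non-zero
  integer, so it is transcribed for EVERY trace-coherent family; statements whose truth depends on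
  the normalisation of `z` against `𝓛^BDP_𝔭` (Thm. 6.2 itself, (6.14), Thm. 6.8 for a given `z`) are
  NOT transcribed here.
* `CW24-local-condition`, `HLV-vs-Kob-layers`, `away-p-compact`, `delta-zero`, `coherent-family`,
  `N⁻ = 1`, `tot-ram-via-h_K`: inherited from the three sibling files (the carriers use
  Hatley–Lei–Vigni's finite-level conditions; `p ∤ h_K`; classical Heegner hypothesis).
* `CW24-53-orientation-L33`, `CW24-text-is-journal` and restrictions (R3)–(R6) of
  `CastellaWan2024/GreenbergMainConjectureBDP.lean`: inherited for the BDP side (`IsCWBDPLFunction ι 𝔭`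
  paired with `AcSelmer.XAc … 𝔭̄`; the typed `L` is the square `L_p^BDP = (𝓛^BDP_𝔭)²` up to the
  unit `u` and the involution `ι_Λ` recorded there; frame quantified existentially).

## NOT in this file (and why)

* Thm. 6.2 (the explicit reciprocity law), (6.12)–(6.15) AS EXACT SEQUENCES / IDENTITIES, Lemma 6.5
  (control at height-one primes), Prop. 3.8: they need the local `Λ^ac`-adic module `H¹_±(K_𝔭, 𝐓^ac)`,
  `Log^±_𝔭`, `coker(loc_𝔭)` (local Iwasawa cohomology is not typed in the tree); Thm. 6.8 AS AN
  EQUIVALENCE for a given class `z` (flag `heegner-normalisation`). Thm. 6.9 / Thm. C (need a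
  non-split prime of `N`, outside the classical Heegner hypothesis of the consumers). Conj. 4.8 / 5.2
  are conjectures — never Literature facts.
* Nothing at `p = 3`: every fact keeps `3 < p` as printed.
-/

noncomputable section

open scoped Classical

open PowerSeries NumberField IsDedekindDomain Field
open Literature.NumberTheory.EllipticCurves Literature.NumberTheory.GaloisRepresentations
open Literature.NumberTheory.EllipticCurves.ModularForms
open Literature.NumberTheory.EllipticCurves.Castella2018
open Literature.NumberTheory.EllipticCurves.CastellaWan2024

universe u

namespace Literature.NumberTheory.EllipticCurves.AcSigned

/-! ## Part 1. "`loc_𝔮(z)` is not `Λ^ac`-torsion" in kernel form -/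

section LocNonTorsion

variable {K : Type u} [Field K] [NumberField K] (W : WeierstrassCurve K) (p : ℕ) [Fact p.Prime]
  (κ : ZpExtension K p) (γ : absoluteGaloisGroup K)

/-- **"`loc_𝔮(z)` is not `Λ^ac`-torsion"** for `z ∈ Sel_ε(K, 𝐓^ac)` (`selmerLambdaAdic … (fun _ ↦
.sgn ε)` with the `ℤ_p⟦T⟧`-structure `moduleOfGen hγ`), in KERNEL FORM: every `f ∈ Λ^ac` with
`f·z ∈ Sel^{str at 𝔮, ε elsewhere}(K, 𝐓^ac)` (`PCond.at 𝔮 .str (.sgn ε)`: strict at `𝔮`, the signed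
condition at the other prime(s) above `p`; classical away from `p`) is `0` — i.e. no non-zero multiple
of `z` dies under `loc_𝔮 : Sel_ε(K, 𝐓^ac) → H¹_ε(K_𝔮, 𝐓^ac)`, whose kernel is `Sel^{str,±}(K, 𝐓^ac)`
(Castella–Wan (6.13); flag `str-vs-loc-zero`). The shape of Cor. 6.4 "The class `loc_𝔭(z^±_∞)` is not
`Λ^ac`-torsion". A predicate; nothing asserted. [cite: CastellaWan2023, Cor. 6.4 and (6.13) (MS pp. 27, 30)] -/
def IsLocNonTorsionAt (𝔮 : HeightOneSpectrum (𝓞 K)) (hγ : κ.IsTopGenerator γ) (ε : ℤˣ)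
    (z : selmerLambdaAdic W p κ γ (fun _ ↦ .sgn ε)) : Prop :=
  letI := selmerLambdaAdic.moduleOfGen W p κ γ hγ (fun _ ↦ PCond.sgn ε)
  ∀ f : IwasawaAlgebra p,
    ((f • z : selmerLambdaAdic W p κ γ (fun _ ↦ .sgn ε)) :
        Π n m : ℕ, W.torsionH1Over ((p : ℤ) ^ m) (κ.layerSubgroup n)) ∈
      selmerLambdaAdic W p κ γ (PCond.at 𝔮 .str (.sgn ε)) → f = 0

variable {W p κ γ}

/-- If `loc_𝔮(z)` is not torsion then `z` itself is not `Λ^ac`-torsion: `f·z = 0` puts `f·z` in every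
subgroup, in particular in `Sel^{str,ε}(K, 𝐓^ac)`. (Cor. 6.4 ⟹ Conj. 4.8 (1), as in the proof of
Thm. 6.8: "the submodule `Sel_±(K, 𝐓^ac)` … contains the non-torsion class `z^±_∞`".)
[cite: CastellaWan2023, Cor. 6.4 and proof of Thm. 6.8 (MS pp. 27, 30)] -/
theorem IsLocNonTorsionAt.smul_eq_zero_imp {𝔮 : HeightOneSpectrum (𝓞 K)} {hγ : κ.IsTopGenerator γ}
    {ε : ℤˣ} {z : selmerLambdaAdic W p κ γ (fun _ ↦ .sgn ε)} (h : IsLocNonTorsionAt W p κ γ 𝔮 hγ ε z)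
    (f : IwasawaAlgebra p)
    (hf : (letI := selmerLambdaAdic.moduleOfGen W p κ γ hγ (fun _ ↦ PCond.sgn ε); f • z) = 0) :
    f = 0 := by
  refine h f ?_
  rw [hf]
  exact zero_mem _

/-- `IsLocNonTorsionAt` descends along non-zero-divisor multiples: if `loc_𝔮(z)` is not torsion and
`g ≠ 0`, then `loc_𝔮(g·z)` is not torsion (`Λ = ℤ_p⟦T⟧` is a domain). [cite: CastellaWan2023, Cor. 6.4 (MS p. 27)] -/
theorem IsLocNonTorsionAt.smul {𝔮 : HeightOneSpectrum (𝓞 K)} {hγ : κ.IsTopGenerator γ} {ε : ℤˣ}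
    {z : selmerLambdaAdic W p κ γ (fun _ ↦ .sgn ε)} (h : IsLocNonTorsionAt W p κ γ 𝔮 hγ ε z)
    {g : IwasawaAlgebra p} (hg : g ≠ 0) :
    IsLocNonTorsionAt W p κ γ 𝔮 hγ ε
      (letI := selmerLambdaAdic.moduleOfGen W p κ γ hγ (fun _ ↦ PCond.sgn ε); g • z) := by
  letI := selmerLambdaAdic.moduleOfGen W p κ γ hγ (fun _ ↦ PCond.sgn ε)
  intro f hf
  rw [smul_smul] at hf
  exact (mul_eq_zero.mp (h (f * g) hf)).resolve_right hg

end LocNonTorsion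

section LocNonTorsionHeegner

variable {K : Type u} [Field K] [NumberField K] {W : WeierstrassCurve ℚ} {p : ℕ} [Fact p.Prime]
  {κ : ZpExtension K p} {γ : absoluteGaloisGroup K}

/-- For the base change `W⁄K`: `IsLocNonTorsionAt` implies `IsNonTorsionClass` (the sibling file's
shape of Conj. 4.8 (1)). [cite: CastellaWan2023, Cor. 6.4 and Conj. 4.8 (1) (MS pp. 22, 27)] -/
theorem IsLocNonTorsionAt.isNonTorsionClass {𝔮 : HeightOneSpectrum (𝓞 K)} {hγ : κ.IsTopGenerator γ}
    {ε : ℤˣ} {z : selmerLambdaAdic (W.baseChange K) p κ γ (fun _ ↦ .sgn ε)}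
    (h : IsLocNonTorsionAt (W.baseChange K) p κ γ 𝔮 hγ ε z) : IsNonTorsionClass hγ ε z :=
  fun f hf ↦ h.smul_eq_zero_imp f hf

end LocNonTorsionHeegner

/-! ## Part 2. Castella–Wan's Cor. 6.4, Lemma 6.7 and Thm. A.5 + Thm. 6.8 (named facts; statements
only, hypotheses as printed — `p > 3` VERBATIM —, specialised as documented) -/

section Facts

variable (N : ℕ) [NeZero N] (W : WeierstrassCurve ℚ) [W.IsGloballyMinimal] (K : Type) [Field K]
  [NumberField K] (p : ℕ) [Fact p.Prime] (κ : ZpExtension K p) (𝔭 𝔭' : HeightOneSpectrum (𝓞 K))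
  (jbar : AlgebraicClosure K →+* ℂ)

/-- **Castella–Wan 2024, Cor. 6.4 (with Lemma 4.7): the localisation `loc_𝔭(z^±_∞)` of the signed
Heegner class is not `Λ^ac`-torsion.** Printed (MS p. 27): "Corollary 6.4. The class `loc_𝔭(z^±_∞)`
is not `Λ^ac`-torsion. *Proof.* Immediate from Theorem 6.2 [the explicit reciprocity law `𝓛^BDP_𝔭/Ξ_d
= σ_{−1,𝔭} · Log^±_𝔭(loc_𝔭(z^±_∞))`] and the non-vanishing result for `𝓛^BDP_𝔭` in Theorem 2.3" (Thm.
2.3, MS p. 7: `μ(𝓛^BDP_𝔭) = 0` when `E[p]` is absolutely irreducible over `G_K`, [Hsi14, Thm. B] /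
[Bur17]); Lemma 4.7 (MS p. 22) "`loc_v(z^±_∞) ∈ H¹_±(K_v, 𝐓^ac)`" makes `loc_𝔭` the map of (6.13),
whose kernel on `Sel_±(K, 𝐓^ac)` is `Sel^{str,±}(K, 𝐓^ac)`. Standing hypotheses of §6 (MS p. 25):
`E/ℚ` of conductor `N`, `p > 3` good supersingular (`a_p = 0`), `K` imaginary quadratic with (gen-H)
and (spl), `𝔭` the prime above `p` induced by `ι_p` (any of the two: the statement for `𝔭̄` is the
one for the conjugate embedding; here `𝔭` is the `Setting`'s first prime, and `Setting` is symmetric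
in `𝔭, 𝔭'`). TRANSCRIBED (special case as in `castellaWan2024_prop44_exists_signedHeegnerClass`:
`N⁻ = 1` = `SatisfiesHeegnerHypothesis N K`, `p ∤ h_K` inside `AcSigned.Setting`, `3 < p` VERBATIM;
flags `str-vs-loc-zero`, `heegner-normalisation`, `coherent-family`, `delta-zero`): for every
topological generator `γ`, every `jbar`, every trace-coherent Heegner family `F` of level `N = N_E`,
every sign `ε` and every `z ∈ Sel_ε(K, 𝐓^ac)` which is the `ε`-signed Heegner class of `F`
(`IsSignedHeegnerClass`), `IsLocNonTorsionAt … 𝔭 … z`. NOT usable at `p = 3` (printed `p > 3`; at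
`p = 3` its printed proof needs Thm. 6.2 at `3` and `𝓛^BDP_𝔭 ≠ 0`).
[cite: CastellaWan2023, Cor. 6.4, Lemma 4.7, Thm. 6.2, Thm. 2.3 and §6 standing hypotheses (MS pp. 7, 22, 25–27)] -/
def castellaWan2024_cor64_isLocNonTorsionAt : Prop :=
  ∀ (_ : Setting W K p κ 𝔭 𝔭'), (W.conductorNorm ℤ : ℕ) = N → SatisfiesHeegnerHypothesis N K →
    3 < p → ∀ (γ : absoluteGaloisGroup K) (hγ : κ.IsTopGenerator γ)
    (F : HeegnerFamily N W K κ jbar), F.IsTraceCoherentApZero → ∀ (ε : ℤˣ)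
    (z : selmerLambdaAdic (W.baseChange K) p κ γ (fun _ ↦ .sgn ε)),
      IsSignedHeegnerClass p κ γ F ε z.1 → IsLocNonTorsionAt (W.baseChange K) p κ γ 𝔭 hγ ε z

/-- **Castella–Wan 2024, Lemma 6.7 (ranks and torsion characteristic ideals of the signed duals).**
Printed (MS p. 28): "Lemma 6.7. The following hold: (1) The modules `X_±` and `Sel_±(K, 𝐓^ac)` have
the same `Λ^ac`-rank. (2) `rank_{Λac}(X^{rel,±}) = 1 + rank_{Λac}(X^{±,str})` and `char_{Λac}(X^{rel,±}_tors)
= char_{Λac}(X^{±,str}_tors)`, where the subscript tors denotes the `Λ^ac`-torsion submodule" — here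
`X^{𝓛_𝔭,𝓛_𝔭̄}` is the Pontryagin dual of `Sel^{𝓛_𝔭,𝓛_𝔭̄}(K, 𝐀^ac)` (Def. 5.1; no relaxation, `Σ = ∅`),
`X^{rel,±}` = relaxed at `𝔭`, signed at `𝔭̄`, `X^{±,str}` = signed at `𝔭`, strict at `𝔭̄` (proof: for
height-one `P ≠ pΛ^ac` outside a finite set, Lemma 6.5 / 6.6 / [Kim07, Prop. 4.11] / [MR04, Thm.
4.1.13] / (6.8) "corank H¹(K_𝔭, A_P) + corank H¹_±(K_𝔭̄, A_P) − corank H⁰(K_w, A_P)` … equal to `2` and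
`1` … and … `2`. Thus `r = 1`" / [AH06, Lem. 1.2.6]). Standing hypotheses of §6 (MS p. 25) as in
`castellaWan2024_cor64_isLocNonTorsionAt`. TRANSCRIBED (special case: `N⁻ = 1`, `p ∤ h_K` in
`Setting`, `3 < p` VERBATIM; flags `CW24-local-condition`, `away-p`, `HLV-vs-Kob-layers`) on the tree's
carriers with the CONSTRUCTED `ℤ_p⟦T⟧`-structures of the generator `γ` (`selmerLambdaAdic.moduleOfGen`,
`X.moduleOfGen`; `T = γ − 1`): (1) as the equality of `Module.finrank`s of `Sel_ε(K, 𝐓^ac) =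
selmerLambdaAdic … (fun _ ↦ .sgn ε)` and `X_ε = X … ∅ (fun _ ↦ .sgn ε)` (ranks of modules over the
domain `Λ`; finite generation of `X_ε` is the tree theorem `AcSigned.X.module_finite`); (2) for the
pair (`PCond.at 𝔭 .rel (.sgn ε)`, `PCond.at 𝔭' .str (.sgn ε)`) with `𝔭` the `Setting`'s first prime
(the statement with `𝔭, 𝔭'` exchanged is the same fact for the conjugate embedding): `finrank X^{rel,±}
= 1 + finrank X^{±,str}` and `X.torsionCharIdeal … (rel,±) = X.torsionCharIdeal … (±,str)`. NOT usable
at `p = 3` (printed `p > 3`; [Kim07, Prop. 4.11] is printed for `p > 3`).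
[cite: CastellaWan2023, Lemma 6.7, Def. 5.1 and §6 standing hypotheses (MS pp. 23, 25, 28–29)]
[cite: BDKim2007, §4 (p. 12 "we fix a prime p > 3"), Prop. 4.11] -/
def castellaWan2024_lemma67_finrank_torsionCharIdeal : Prop :=
  ∀ (_ : Setting W K p κ 𝔭 𝔭'), (W.conductorNorm ℤ : ℕ) = N → SatisfiesHeegnerHypothesis N K →
    3 < p → ∀ (γ : absoluteGaloisGroup K) (hγ : κ.IsTopGenerator γ) (ε : ℤˣ),
    (letI := selmerLambdaAdic.moduleOfGen (W.baseChange K) p κ γ hγ (fun _ ↦ PCond.sgn ε)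
     letI := X.moduleOfGen (W.baseChange K) p κ ∅ (fun _ ↦ PCond.sgn ε) hγ
     Module.finrank (IwasawaAlgebra p) (selmerLambdaAdic (W.baseChange K) p κ γ (fun _ ↦ .sgn ε)) =
       Module.finrank (IwasawaAlgebra p) (X (W.baseChange K) p κ ∅ (fun _ ↦ .sgn ε))) ∧
    (letI := X.moduleOfGen (W.baseChange K) p κ ∅ (PCond.at 𝔭 .rel (.sgn ε)) hγ
     letI := X.moduleOfGen (W.baseChange K) p κ ∅ (PCond.at 𝔭' .str (.sgn ε)) hγ
     Module.finrank (IwasawaAlgebra p) (X (W.baseChange K) p κ ∅ (PCond.at 𝔭 .rel (.sgn ε))) =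
       1 + Module.finrank (IwasawaAlgebra p) (X (W.baseChange K) p κ ∅ (PCond.at 𝔭' .str (.sgn ε)))) ∧
    X.torsionCharIdeal (W.baseChange K) p κ ∅ (PCond.at 𝔭 .rel (.sgn ε)) hγ =
      X.torsionCharIdeal (W.baseChange K) p κ ∅ (PCond.at 𝔭' .str (.sgn ε)) hγ

/-- **Castella–Wan 2024, Thm. A.5 + Thm. 6.8 ("opposite divisibilities"): for `N` squarefree,
`Sel^{str,rel}(K, 𝐓^ac)` and `X^{rel,str}` are `Λ^ac`-torsion and `char_{Λac}(X^{rel,str}) Λ^ur ⊃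
(L_p^BDP)`** — the `⊇`/Howard half of the Iwasawa–Greenberg statement 5.2 for `L_p^BDP`, DEDUCED
(a theorem) from the `±` Heegner-point Kolyvagin system; the ENGINE OUTPUT of the crux's port. Printed pieces (flag `composite-A5-68`):
Thm. A.5 (MS pp. 35–36) "Assume that `N` is squarefree. Then the module `Sel_±(K, 𝐓^ac)` has
`Λ^ac`-rank one, and there is a finitely generated `Λ^ac`-module `M` such that: (i) `X_± ∼ Λ^ac ⊕ M ⊕
M`, (ii) We have the divisibility `char_{Λac}(M) ⊃ char_{Λac}(Sel_±(K, 𝐓^ac)/Λ^ac z^±_∞)` in `Λ^ac`"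
(so clause (i) of Thm. 6.8 holds with `⊃`: both ranks are one and `char(X^±_tors) = char(M)² ⊃
char(Sel_±(K, 𝐓^ac)/Λ^ac z^±_∞)²`); Thm. 6.8 (MS p. 30) "(i) Both `Sel_±(K, 𝐓^ac)` and `X_±` have
`Λ^ac`-rank one, and … `char(X^±_tors) ⊂ char(Sel_±(K, 𝐓^ac)/Λ^ac z^±_∞)²`. (ii) Both `Sel^{str,rel}(K,
𝐓^ac)` and `X^{rel,str}` are `Λ^ac`-torsion, and … `char_{Λac}(X^{rel,str}) Λ^ur ⊂ (L_p^BDP)`. The same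
result holds for the opposite divisibilities" (proof via `E(K_∞)[p^∞] = 0` ⟹ `H¹(K, 𝐓^ac)`
torsion-free [PR00, §1.3.3], global duality (6.12)–(6.13), `H¹_±(K_𝔭, 𝐓^ac) ≃ Λ^ac` (Prop. 3.8),
Thm. 6.2, Cor. 6.4, Lemma 6.7, (6.14)–(6.15)); `L_p^BDP := (𝓛^BDP_𝔭)²` ((2.2)) with `𝓛^BDP_𝔭 ∈ Λ^ur`
characterised by Prop. 2.1; proof of Thm. 6.9 (MS p. 31) composes them in words. Hypotheses (union):
§6 standing (MS p. 25) `E/ℚ` of conductor `N` with newform `f`, `p > 3` good supersingular, `K`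
imaginary quadratic with (gen-H) and (spl), `𝔭` induced by `ι_p`; `N` squarefree (A.5). TRANSCRIBED
(special case, flags `composite-A5-68`, `N⁻ = 1`, `delta-zero`, `tot-ram-via-h_K`,
`CW24-local-condition`, `away-p`, `CW24-53-orientation-L33`, (R3)–(R6) of the sibling BDP file): in
`AcSigned.Setting` (adds `p ∤ h_K`), `N⁻ = 1` (`SatisfiesHeegnerHypothesis N K`), `3 < p` VERBATIM,
`Squarefree N`, `f` the newform of `W` of level `N = N_E`, an embedding datum `ι : ℚ̄_p^alg ≃ ℂ`
INDUCING `𝔭` (`k ∈ 𝔭 ↔ ‖ι⁻¹(w(k))‖ < 1`, as in `thm53_…`), `γ` a topological generator: THEN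
`Sel^{str at 𝔭, rel at 𝔭'}(K, 𝐓^ac)` (`selmerLambdaAdic … (PCond.at 𝔭 .str .rel)`) is `Λ`-torsion,
`X^{rel,str}` (`X … ∅ (PCond.at 𝔭' .str .rel)`, whose Selmer group IS `AcSelmer.selmerAc … 𝔭'` by
`AcSigned.selmer_at_str_rel_eq_selmerAc`) is finitely generated `Λ`-torsion, and there is a frame
`(Ω_K ≠ 0, Ω_p ∈ R₀ˣ, L ∈ R₀⟦T⟧)` with `IsCWBDPLFunction ι 𝔭 κ γ f D_K Ω_K Ω_p L` (Prop. 2.1 for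
`L = ι_Λ(u · L_p^BDP)`) such that, along THE structure map `j : ℤ_p → R₀`, `L ∈ char_Λ(XAc … 𝔭') ·
R₀⟦T⟧` — the OPPOSITE inclusion to `CastellaWan2024.thm53_exists_isCWBDPLFunction_charIdeal_map_le`,
on the same objects. WEAKER than print, never stronger (frame existential; `X_tors ∼ M ⊕ M` and the
`z`-clauses are the sibling fact `castellaWan2024_thmA5_signedSelmer_rank_one_dvd_sq`). NOT usable at
`p = 3`: deleting `3 < p` gives (up to the normalisation concordance between `IsCWBDPLFunction` and
`IsBDPLFunction`, a binder recorded in the sibling BDP file, item (b) there) the statement of the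
crux's `stub_howardFrameSS_apZero`; this file establishes nothing at `p = 3`. A PROVED, REFEREED
THEOREM of the source (the composition of two displayed theorems), typed as a named fact.
[cite: CastellaWan2023, Thm. A.5 (MS pp. 35–36), Thm. 6.8 (MS pp. 29–31), proof of Thm. 6.9 (MS p. 31), (2.2) and Prop. 2.1 (MS pp. 5–8), Def. 5.1 (MS p. 23), §6 standing hypotheses (MS p. 25)]
[cite: Castella2018, Def. 2.2 (the tree object `AcSelmer.XAc`)] -/
def castellaWan2024_thmA5_thm68_bdp_mem_charIdeal : Prop :=
  ∀ (_ : Setting W K p κ 𝔭 𝔭') (ι : PadicAlgCl p ≃+* ℂ) {f : CuspForm (CongruenceSubgroup.Gamma0 N) 2}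
    (_ : IsNewformOf W f), (W.conductorNorm ℤ : ℕ) = N → SatisfiesHeegnerHypothesis N K →
    3 < p → Squarefree N →
    (∀ (w : InfinitePlace K) (k : 𝓞 K), k ∈ 𝔭.asIdeal ↔ ‖ι.symm (w.embedding (k : K))‖ < 1) →
    ∀ (γ : absoluteGaloisGroup K) [Fact (κ.IsTopGenerator γ)],
      selmerLambdaAdic.IsTorsion (W.baseChange K) p κ γ Fact.out (PCond.at 𝔭 .str .rel) ∧
      X.IsFGTorsion (W.baseChange K) p κ ∅ (PCond.at 𝔭' .str .rel) (Fact.out : κ.IsTopGenerator γ) ∧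
      ∃ (ΩK : ℂ) (Ωp : (unrIntegers p)ˣ) (L : UnrSeries p),
        ΩK ≠ 0 ∧
        IsCWBDPLFunction ι 𝔭 κ γ f (NumberField.discr K) ΩK ((Ωp : unrIntegers p) : ℂ_[p]) L ∧
        ∀ (j : ℤ_[p] →+* unrIntegers p),
          (∀ x : ℤ_[p], ((j x : unrIntegers p) : ℂ_[p]) = algebraMap ℚ_[p] ℂ_[p] (x : ℚ_[p])) →
          L ∈ (AcSelmer.XAc.charIdeal (W.baseChange K) p κ 𝔭' ∅ γ).map (PowerSeries.map j)

end Facts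

/-! ## Part 3. Bookkeeping (PROVED): projections a consumer uses -/

section Bookkeeping

variable {N : ℕ} [NeZero N] {W : WeierstrassCurve ℚ} [W.IsGloballyMinimal] {K : Type} [Field K]
  [NumberField K] {p : ℕ} [Fact p.Prime] {κ : ZpExtension K p} {𝔭 𝔭' : HeightOneSpectrum (𝓞 K)}
  {jbar : AlgebraicClosure K →+* ℂ}

/-- From Cor. 6.4 (the fact) the signed Heegner class is not `Λ^ac`-torsion (Conj. 4.8 (1) at
`p > 3`, as printed after Cor. 6.4 / in the proof of Thm. 6.8). Bookkeeping projection.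
[cite: CastellaWan2023, Cor. 6.4 and proof of Thm. 6.8 (MS pp. 27, 30)] -/
theorem isNonTorsionClass_of_cor64 (h : castellaWan2024_cor64_isLocNonTorsionAt N W K p κ 𝔭 𝔭' jbar)
    (hS : Setting W K p κ 𝔭 𝔭') (hN : (W.conductorNorm ℤ : ℕ) = N) (hH : SatisfiesHeegnerHypothesis N K)
    (hp : 3 < p) {γ : absoluteGaloisGroup K} (hγ : κ.IsTopGenerator γ) {F : HeegnerFamily N W K κ jbar}
    (hF : F.IsTraceCoherentApZero) {ε : ℤˣ}
    {z : selmerLambdaAdic (W.baseChange K) p κ γ (fun _ ↦ .sgn ε)}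
    (hz : IsSignedHeegnerClass p κ γ F ε z.1) : IsNonTorsionClass hγ ε z :=
  (h hS hN hH hp γ hγ F hF ε z hz).isNonTorsionClass

/-- The BDP-side conclusion of Thm. A.5 + Thm. 6.8 alone (dropping the torsion clauses): a frame
`(Ω_K, Ω_p, L)` with `L ∈ char_Λ(XAc … 𝔭') · R₀⟦T⟧`. Bookkeeping projection.
[cite: CastellaWan2023, Thm. A.5 and Thm. 6.8 (MS pp. 30, 35–36)] -/
theorem exists_isCWBDPLFunction_mem_charIdeal_of_thmA5_thm68
    (h : castellaWan2024_thmA5_thm68_bdp_mem_charIdeal N W K p κ 𝔭 𝔭')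
    (hS : Setting W K p κ 𝔭 𝔭') (ι : PadicAlgCl p ≃+* ℂ) {f : CuspForm (CongruenceSubgroup.Gamma0 N) 2}
    (hf : IsNewformOf W f) (hN : (W.conductorNorm ℤ : ℕ) = N) (hH : SatisfiesHeegnerHypothesis N K)
    (hp : 3 < p) (hsq : Squarefree N)
    (hι : ∀ (w : InfinitePlace K) (k : 𝓞 K), k ∈ 𝔭.asIdeal ↔ ‖ι.symm (w.embedding (k : K))‖ < 1)
    (γ : absoluteGaloisGroup K) [Fact (κ.IsTopGenerator γ)] :
    ∃ (ΩK : ℂ) (Ωp : (unrIntegers p)ˣ) (L : UnrSeries p),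
      ΩK ≠ 0 ∧
      IsCWBDPLFunction ι 𝔭 κ γ f (NumberField.discr K) ΩK ((Ωp : unrIntegers p) : ℂ_[p]) L ∧
      ∀ (j : ℤ_[p] →+* unrIntegers p),
        (∀ x : ℤ_[p], ((j x : unrIntegers p) : ℂ_[p]) = algebraMap ℚ_[p] ℂ_[p] (x : ℚ_[p])) →
        L ∈ (AcSelmer.XAc.charIdeal (W.baseChange K) p κ 𝔭' ∅ γ).map (PowerSeries.map j) :=
  (h hS ι hf hN hH hp hsq hι γ).2.2

end Bookkeeping

end Literature.NumberTheory.EllipticCurves.AcSigned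

end
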